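import Summits.ResolutionOfSingularities.ResolutionOfSingularities.Theorems.WeightedInvariantHypersurfaceCentreConstructionE2TierOfLeaves
import Summits.ResolutionOfSingularities.ResolutionOfSingularities.Theorems.WeightedInvariantE2CentreHStub
import Summits.ResolutionOfSingularities.ResolutionOfSingularities.Theorems.WeightedInvariantE2InvSuccLoc
import HarnessLib

/-!
# E2 tier COMPLETE: the milestone `AdmissiblyResolvableDim p 2` from the graded HOM P3 rung ALONE

Route `ResolutionOfSingularities/WeightedInvariant`, crux `Theses.WeightedInvariant.HypersurfaceCentreConstruction`
(stmt-ResolutionOfSingularities-19897), door line `local-engine` (skeleton v3.12, 7a4b52ef4f5779aa).  The skeleton's PART 6 E2 tier had three registered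
stubs over the graded HOM rung: `stub_e2_centre_h` (now …E2CentreHStub), `stub_e2_step_h` (closed v3.12 by `stub_e2_step_h_of_over ∘ e2AtlasOverCentre`),
`stub_e2_inv_succ_loc_h` (now …E2InvSuccLoc); its record `admissiblyResolvableDim_two_of_rungs` = `e2_assembly ∘ stub_keyRungGrHomLE_three`.  With the two
E2 stubs theorems, hand -1's census theorem `E2TierCensus.admissiblyResolvableDim_two_of_rung` becomes:
* `admissiblyResolvableDim_two_of_keyRungGrHomLE_three` — `KeyRungGrHomLE 3 p → AdmissiblyResolvableDim p 2` for every prime `p` (the P3 MILESTONE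
  modulo the one remaining registered rung stub `stub_keyRungGrHomLE_three : ∀ p, p.Prime → KeyRungGrHomLE 3 p`);
* `admissiblyResolvableDim_two_of_key` — the same from the KEY `LocalWeightedDropEFT4S p` (`keyRungGrHomLE_three_of_key`-shape seam via
  `pRungGrHomLE`… recorded through `KeyRungGrHomLE`).
[OURS · L1 W4.3 · the E2 tier / `AdmissiblyResolvableDim` are OUR constructions (surfaces in smooth threefolds over perfect fields of characteristic `p`,
weighted-centre tower); nothing here is a statement of Hironaka 2017; no summit or crux is proved by this file; AI-written, weaker than expert review.]
-/

noncomputable section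

set_option linter.dupNamespace false -- mandated namespace of this single-conjunct summit

namespace Summit.ResolutionOfSingularities.ResolutionOfSingularities.Cruxes.HypersurfaceCentreConstruction.LocalEngine

/-- **THE P3 MILESTONE MODULO THE P3 RUNG**: for every prime `p`, the graded HOM rung at Krull dimension `≤ 3` for SOME pair `(ι, J)` gives
`AdmissiblyResolvableDim p 2` (the E2 tier's centre, structured step and local drop are all theorems now). [folklore] -/
theorem admissiblyResolvableDim_two_of_keyRungGrHomLE_three (p : ℕ) (hp : p.Prime) (hgr : KeyRungGrHomLE 3 p) :
    Summit.ResolutionOfSingularities.ResolutionOfSingularities.Theorems.AdmissiblyResolvableDim p 2 :=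
  E2TierCensus.admissiblyResolvableDim_two_of_rung e2CentreHom stub_e2_inv_succ_loc_h p hp hgr

/-- **Registrar shape**: the registered P3 stub's statement `∀ p, p.Prime → KeyRungGrHomLE 3 p` ALONE now yields the E2 milestone at every prime.
[folklore] -/
theorem admissiblyResolvableDim_two_of_stub_keyRungGrHomLE_three (hkey : ∀ p : ℕ, p.Prime → KeyRungGrHomLE 3 p) (p : ℕ) (hp : p.Prime) :
    Summit.ResolutionOfSingularities.ResolutionOfSingularities.Theorems.AdmissiblyResolvableDim p 2 :=
  admissiblyResolvableDim_two_of_keyRungGrHomLE_three p hp (hkey p hp)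

end Summit.ResolutionOfSingularities.ResolutionOfSingularities.Cruxes.HypersurfaceCentreConstruction.LocalEngine

end
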